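import Summits.ABC.IUTFork.Conditional.HexDepthRadCoreAllE
import Summits.ABC.IUTFork.Conditional.AbcOfSGenuineKChosenDepthRad
import Summits.ABC.IUTFork.Conditional.HexDepthExplicitFloor
import HarnessLib

/-!
# Branch C / R-W lane P− «HEX-SHARP», the RAD-UNIFORM FLOOR: for every prime `l ∈ {11,…,43}` of the table and every
# `k ≥ k♯(l) = 30, 29, 29, 29, 28, 29, 29, 29, 30, 30`, EVERY genuine Θ-volume datum over `λ_k = 1/2 + 2/7^k` violates the
# hull-level clause S_H at the top label over `7` (per datum; exact-radius / envelope engine)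

PROOF-ONLY file (D-0012; 0 definitions, 0 `Prop` facts) of the abc-iut cell (D-0079 R-W numerics crew seat abc-iut-W-num-6, gen 0 —
the datum wrapper of RECIPE «RAD-UNIFORM», HOME/abc-iut-W-num-6/census/k2/). TAKES NO SIDE on [IUTchIII] Cor. 3.12 (S. Mochizuki,
*Inter-universal Teichmüller theory III*, RIMS manuscript, Cor. 3.12 pp. 173–174, Step (xi-f) p. 184) or on any author.

WHAT IS ADDED (composition BY NAME; no new engine, no new arithmetic). abc-iut-c312-7's interface `GenuineK.exists_place_lamSeven`
gives at every datum `T` over `(ratPoint λ_k, l)` a bad place `x₀ | 7` with `7 ∤ e`, `e ≤ E(l) := 46080·l(l−1)²(l+1)` and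
`‖t_q(x₀)‖ = 7^{−k/l}` for the chosen realising q-idele; abc-iut-w5-d009's `Cor312Prov.exists_nat_qPilot_pilotDataOfK` gives the integral
q-degree `P` with `‖t_q(x₀)‖ = 7^{−P/e}` (abc-iut-w5-d236 `norm_qIdele_eq_rpow_intCast_of_realises`), so `P/e = k/l`; abc-iut-c312-3's
turning point `a₀` of `e` (`LogEnvelope.exists_turning`) and `d = (e−1)/e < 1` (`differentOrd_eq_of_not_dvd`); then this seat's arithmetic
cores `HexRad.logExponent_lt_floor_of_criterion₃` (`3 ≤ e`, uniform in `e ≤ E(l)` by `LogEnvelope.envelope_logExponent_le_of_le`) /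
`HexRad.logExponent_lt_floor_small` (`e ≤ 2`) deliver exactly the test inequality of abc-iut-w5-d236's
`GenuineK.not_pilotKummerCompatHull_chosen_of_star_envelope` (p463434; abc-iut-c312-3's envelope socket p454852 at the genuine `K` datum).
* `HexRad.not_pilotKummerCompatHull_lamSeven_of_rad_criterion` — per datum ¬S_H from the RAD-UNIFORM integer criterion at `E(l)`
  (hypotheses: the turning point `S` of `E(l)` and one certified row `(k, F)`; both supplied by `HexDepthRadCore(AllE)` tables);
* `HexRad.not_pilotKummerCompatHull_lamSeven_of_rad_table` — the DECIDED rows: `l ∈ {11, 13, 17, 19, 23, 29, 31, 37, 41, 43}` and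
  `k ≥ k♯(l) = 30, 29, 29, 29, 28, 29, 29, 29, 30, 30`, versus `35, 34, 33, …` of the tame-route floor `HexFloor` (p455580) at the same `E(l)`.
R-W reading (WINDOW-SPEC §3b/§6): every WINDOW-TABLE class `HEX:k:l` with `k ≥ k♯(l)` is REFUTED BY THEOREM (deciding decl here).
HONEST SCOPE: SHARP reading at the chosen realising ideles, pinned hull; the per-label licence is a STRONGER-THAN-PRINT sufficient form of
(xi-f); nothing about the printed GLOBAL inequality, the number-level `Cor22.Cor312AtDatum` (every HEX datum is Szpiro-good: off the
conditional certificate's critical path) or any author's intended hull; typed ≠ proved; refuted-as-typed ≠ refuted-in-print; no abc claim.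
[cite: Mochizuki2012, IUTchIII Cor. 3.12 Step (xi-f) p. 184; IUTchIV Prop. 1.1 p. 9, Prop. 1.2 (i)(ii) p. 10, Cor. 2.2 (ii) proof (P5) p. 46]
[cite: DupuyHilado2025, §3.4, §4.9, §4.12] [cite: NeukirchANT1999, Ch. II (5.5)] [cite: ScholzeStix2018, §2.2 pp. 9–10]
[claim: Mochizuki2012, status: disputed] for every IUT quotation.
-/

noncomputable section

open Set Function NumberField IsDedekindDomain

namespace Summit.ABC.IUTFork.Conditional

open Thm311 Thm311.Real Cor312 Cor312Vol Cor312Prov Literature.IUT.LogThetaLattice Literature.IUT.LogVolume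
  Literature.IUT.HodgeTheaters Literature.IUT.LogVolume.ThetaData
  Literature.NumberTheory.DiophantineGeometry.GenEll Summit.ABC.ABC.Theorems

namespace HexRad

/-- **S_H FAILS at every datum over `(λ_k, l)` satisfying the RAD-UNIFORM criterion at `E(l) = 46080·l(l−1)²(l+1)`.** For `k ≥ 7`,
`l` prime `≥ 11`, the turning point `S` of `E(l)` and one certified row `(k, F)` of the `e ≥ 3` criterion, at every genuine Θ-volume
datum `T` over `(ratPoint λ_k, l)` and for EVERY choice of the free context binders and Kummer datum, the hull-level clause
`Cor312Vol.PilotKummerCompatHull` at the sharp genuine `K`-setting with the CHOSEN realising ideles and the PINNED reading FAILS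
(exact-radius engine p463434 ← p454852). [cite: Mochizuki2012, IUTchIII Cor. 3.12 Step (xi-f) p. 184; IUTchIV Prop. 1.2 p. 10]
[claim: Mochizuki2012, status: disputed] -/
theorem not_pilotKummerCompatHull_lamSeven_of_rad_criterion {k l S : ℕ} (hk : 7 ≤ k) (hl : l.Prime) (h11 : 11 ≤ l)
    (hloS : ∀ a < S, (7 : ℤ) ^ a * ((7 : ℤ) - 1) < ((46080 * (l * (l - 1) ^ 2 * (l + 1)) : ℕ) : ℤ))
    (hhiS : (((46080 * (l * (l - 1) ^ 2 * (l + 1)) : ℕ) : ℤ)) ≤ (7 : ℤ) ^ S * ((7 : ℤ) - 1))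
    (hrow : ∃ F : ℤ, 3 * (l : ℤ) * F ≤ 3 * ((l - 1) / 2 : ℕ) ^ 2 * k - 3 * ((l - 1) / 2 : ℕ) * l - (((l - 1) / 2 : ℕ) + 1) * l ∧
      (((l - 1) / 2 : ℕ) + 1 : ℤ) * l * (S * ((46080 * (l * (l - 1) ^ 2 * (l + 1)) : ℕ) : ℤ) - 7 ^ S)
        < (F * l - k) * ((46080 * (l * (l - 1) ^ 2 * (l + 1)) : ℕ) : ℤ))
    (T : Cor22.ThetaVolumeDatumAt (ratPoint ((2 : ℚ)⁻¹ + 2 / 7 ^ k)) l) :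
    letI := T.instFieldF; letI := T.instNumberFieldF; letI := T.instAlgebraF; letI := T.instFieldK
    letI := T.instNumberFieldK; letI := T.instAlgebraK; letI := T.instFieldFbar; letI := T.instAlgebraFbar
    letI := T.instAlgebraKFbar; letI := T.instIsElliptic
    ∀ (M : Type) [Field M] [NumberField M]
      (archPk : ∀ (j : (thetaIndex (pilotDataOfK T.D T.K)).Label) (vQ : (thetaIndex (pilotDataOfK T.D T.K)).VQ),
        Set ((logShellsDH (pilotDataOfK T.D T.K) (analyticLogv T.K)).Packet j vQ))
      (archSub : ∀ (j : (thetaIndex (pilotDataOfK T.D T.K)).Label) (v : (thetaIndex (pilotDataOfK T.D T.K)).V),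
        Set ((logShellsDH (pilotDataOfK T.D T.K) (analyticLogv T.K)).Packet j ((thetaIndex (pilotDataOfK T.D T.K)).over v)))
      (Ψ : ℤ → ∀ v : (thetaIndex (pilotDataOfK T.D T.K)).V, v ∈ (thetaIndex (pilotDataOfK T.D T.K)).Vbad →
        Set ((logShellsDH (pilotDataOfK T.D T.K) (analyticLogv T.K)).StarPacket v))
      (act : ℤ → ∀ v : (thetaIndex (pilotDataOfK T.D T.K)).V, v ∈ (thetaIndex (pilotDataOfK T.D T.K)).Vbad →
        (logShellsDH (pilotDataOfK T.D T.K) (analyticLogv T.K)).StarPacket v →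
          Module.End ℚ ((logShellsDH (pilotDataOfK T.D T.K) (analyticLogv T.K)).StarPacket v))
      (Mmod : ℤ → ∀ j : (thetaIndex (pilotDataOfK T.D T.K)).LabelStar,
        Set ((logShellsDH (pilotDataOfK T.D T.K) (analyticLogv T.K)).GlobalPacket j.1))
      (region : ℤ → ∀ j : (thetaIndex (pilotDataOfK T.D T.K)).LabelStar, FinDivisor M →
        ∀ vQ : (thetaIndex (pilotDataOfK T.D T.K)).VQ, Set ((logShellsDH (pilotDataOfK T.D T.K) (analyticLogv T.K)).Packet j.1 vQ))
      (frobAdm : ℤ → ℤ → ∀ (j : (thetaIndex (pilotDataOfK T.D T.K)).Label) (vQ : (thetaIndex (pilotDataOfK T.D T.K)).VQ),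
        Set ((logShellsDH (pilotDataOfK T.D T.K) (analyticLogv T.K)).Packet j vQ) → Prop)
      (frobLogvol : ℤ → ℤ → ∀ (j : (thetaIndex (pilotDataOfK T.D T.K)).Label) (vQ : (thetaIndex (pilotDataOfK T.D T.K)).VQ),
        Set ((logShellsDH (pilotDataOfK T.D T.K) (analyticLogv T.K)).Packet j vQ) → ℝ)
      (frobΨ : ℤ → ℤ → ∀ v : (thetaIndex (pilotDataOfK T.D T.K)).V, v ∈ (thetaIndex (pilotDataOfK T.D T.K)).Vbad →
        Set ((logShellsDH (pilotDataOfK T.D T.K) (analyticLogv T.K)).StarPacket v))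
      (frobMmod : ℤ → ℤ → ∀ j : (thetaIndex (pilotDataOfK T.D T.K)).LabelStar,
        Set ((logShellsDH (pilotDataOfK T.D T.K) (analyticLogv T.K)).GlobalPacket j.1))
      (unitImage : ℤ → ℤ → ℕ → ∀ (j : (thetaIndex (pilotDataOfK T.D T.K)).Label) (vQ : (thetaIndex (pilotDataOfK T.D T.K)).VQ),
        Set ((logShellsDH (pilotDataOfK T.D T.K) (analyticLogv T.K)).Packet j vQ))
      (ballImage : ℤ → ℤ → ∀ (j : (thetaIndex (pilotDataOfK T.D T.K)).Label) (vQ : (thetaIndex (pilotDataOfK T.D T.K)).VQ),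
        Set ((logShellsDH (pilotDataOfK T.D T.K) (analyticLogv T.K)).Packet j vQ))
      (thetaDiv : ℤ → ℤ → LgpDivisor M (thetaIndex (pilotDataOfK T.D T.K)).lstar)
      (n : ℤ) {HT : Type} {LogLink : HT → HT → Type} {IsFull : ∀ {s t : HT}, LogLink s t → Prop}
      (lat : LGPGaussianLogThetaLattice LogLink IsFull)
      {Frd : Type} {IsoF : Frd → Frd → Type} {Ob : Frd → Type} {realify : Frd → Frd} {Strip : Type}
      {IsoS : Strip → Strip → Type} {Mv : ∀ v : (thetaIndex (pilotDataOfK T.D T.K)).V, v ∈ (thetaIndex (pilotDataOfK T.D T.K)).Vbad → Type}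
      [∀ v h, Monoid (Mv v h)]
      (sig : GlobalLGPFrobenioidSignature (thetaIndex (pilotDataOfK T.D T.K)).lstar (thetaIndex (pilotDataOfK T.D T.K)).V
        (· ∈ (thetaIndex (pilotDataOfK T.D T.K)).Vbad) Frd IsoF Ob realify Strip IsoS Mv)
      (split : SplittingMonoids Mv) {ObΔ : Type}
      {N : ∀ v : (thetaIndex (pilotDataOfK T.D T.K)).V, v ∈ (thetaIndex (pilotDataOfK T.D T.K)).Vbad → Type}
      [∀ v h, Monoid (N v h)] (qData : QPilotData ObΔ N)
      (qK : ∀ v : (thetaIndex (pilotDataOfK T.D T.K)).V, v ∈ (thetaIndex (pilotDataOfK T.D T.K)).Vbad →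
        Set ((logShellsDH (pilotDataOfK T.D T.K) (analyticLogv T.K)).StarPacket v)),
    ¬ Cor312Vol.PilotKummerCompatHull
        (LatticeSituation.ofShells (logShellsDH (pilotDataOfK T.D T.K) (analyticLogv T.K)) M archPk archSub
          (summandPiecesPr (pilotDataOfK T.D T.K) (logvAnalytic_analyticLogv (F := T.K))).Adm
          (summandPiecesPr (pilotDataOfK T.D T.K) (logvAnalytic_analyticLogv (F := T.K))).logvol Ψ act Mmod region frobAdm
          frobLogvol frobΨ frobMmod unitImage ballImage thetaDiv)
        (settingPrVolSharp (pilotDataOfK T.D T.K) (logvAnalytic_analyticLogv (F := T.K)) M archPk archSub Ψ act Mmod region n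
          lat sig split qData (exists_realising_qIdeles_pilotDataOfK T.D).choose (exists_realising_thetaIdeles_pilotDataOfK T.D).choose
          (exists_realising_qIdeles_pilotDataOfK T.D).choose_spec.1 (exists_realising_qIdeles_pilotDataOfK T.D).choose_spec.2.1)
        (fun _ => Cor312.Setting.qRegion
          (settingPrVolSharp (pilotDataOfK T.D T.K) (logvAnalytic_analyticLogv (F := T.K)) M archPk archSub Ψ act Mmod region n
            lat sig split qData (exists_realising_qIdeles_pilotDataOfK T.D).choose (exists_realising_thetaIdeles_pilotDataOfK T.D).choose
            (exists_realising_qIdeles_pilotDataOfK T.D).choose_spec.1 (exists_realising_qIdeles_pilotDataOfK T.D).choose_spec.2.1))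
        qK := by
  letI := T.instFieldF; letI := T.instNumberFieldF; letI := T.instAlgebraF; letI := T.instFieldK
  letI := T.instNumberFieldK; letI := T.instAlgebraK; letI := T.instFieldFbar; letI := T.instAlgebraFbar
  letI := T.instAlgebraKFbar; letI := T.instIsElliptic
  intro M _ _ archPk archSub Ψ act Mmod region frobAdm frobLogvol frobΨ frobMmod
    unitImage ballImage thetaDiv n HT LogLink IsFull lat Frd IsoF Ob realify Strip IsoS Mv _ sig split ObΔ N _ qData qK
  haveI h7 : Fact (Nat.Prime 7) := ⟨by norm_num⟩
  obtain ⟨x₀, hS, htame, hbound, -, hnorm⟩ := GenuineK.exists_place_lamSeven (show 1 ≤ k by omega) hl h11 T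
  -- the top label `i₀ + 1 = j = (l-1)/2`
  have hlstar : (thetaIndex (pilotDataOfK T.D T.K)).lstar = (l - 1) / 2 := rfl
  have hj5 : 5 ≤ (l - 1) / 2 := by omega
  have hil : (l - 1) / 2 - 1 < (thetaIndex (pilotDataOfK T.D T.K)).lstar := by rw [hlstar]; omega
  set i₀ : Fin (thetaIndex (pilotDataOfK T.D T.K)).lstar := ⟨(l - 1) / 2 - 1, hil⟩ with hi₀
  have hi₀v : (i₀ : ℕ) = (l - 1) / 2 - 1 := rfl
  have hodd : l % 2 = 1 := by
    rcases hl.eq_two_or_odd with h | h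
    · omega
    · exact h
  -- the ramification index, its turning point, the exact different
  set e : ℕ := absRamificationIdx 7 (kOf (pilotDataOfK T.D T.K) 7 x₀) with he
  have he1 : 1 ≤ e := absRamificationIdx_pos 7 (kOf (pilotDataOfK T.D T.K) 7 x₀)
  have he0 : (0 : ℝ) < e := by exact_mod_cast he1
  obtain ⟨a₀, hlo, hhi⟩ := LogEnvelope.exists_turning (p := 7) e
  have hd : differentOrd 7 (kOf (pilotDataOfK T.D T.K) 7 x₀) < 1 := by
    rw [differentOrd_eq_of_not_dvd 7 (kOf (pilotDataOfK T.D T.K) 7 x₀) htame]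
    rw [div_lt_one he0]
    linarith
  -- the integral q-degree `P` and `P/e = k/l`
  obtain ⟨P, hP, hP1, -⟩ := Cor312Prov.exists_nat_qPilot_pilotDataOfK T.D hS
  have hPnorm : ‖(exists_realising_qIdeles_pilotDataOfK T.D).choose ⟨7, by norm_num⟩ x₀‖ =
      (7 : ℝ) ^ (-(((P : ℤ) : ℝ) / absRamificationIdx 7 (kOf (pilotDataOfK T.D T.K) 7 x₀))) := by
    have h := norm_qIdele_eq_rpow_intCast_of_realises (pilotDataOfK T.D T.K)
      (exists_realising_qIdeles_pilotDataOfK T.D).choose (exists_realising_qIdeles_pilotDataOfK T.D).choose_spec.1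
      (exists_realising_qIdeles_pilotDataOfK T.D).choose_spec.2.2 ⟨7, by norm_num⟩ x₀ P hP
    exact_mod_cast h
  have h71 : (1 : ℝ) < 7 := by norm_num
  have hμ : ((P : ℤ) : ℝ) / e = (k : ℝ) / l := by
    have heq : (7 : ℝ) ^ (-((k : ℝ) / l)) = (7 : ℝ) ^ (-(((P : ℤ) : ℝ) / e)) := by
      rw [← hnorm, hPnorm]
    have h1 := (Real.rpow_le_rpow_left_iff h71).mp heq.le
    have h2 := (Real.rpow_le_rpow_left_iff h71).mp heq.ge
    linarith
  -- the arithmetic core, by cases on `e`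
  set jj : ℕ := (l - 1) / 2 with hjj
  have hcore : (k : ℝ) / l + (((jj : ℕ) : ℝ) + 1) * ((a₀ : ℝ) - (7 : ℝ) ^ a₀ / e) <
      ⌊(((jj : ℕ) : ℝ)) ^ 2 * k / l - ((jj : ℕ) : ℝ) * differentOrd 7 (kOf (pilotDataOfK T.D T.K) 7 x₀)
          - ((((jj : ℕ) : ℝ)) + 1) * logRadiusA 7 e⌋ := by
    have hlo' : ∀ a < a₀, (7 : ℤ) ^ a * ((7 : ℤ) - 1) < e := fun a ha => by exact_mod_cast hlo a ha
    have hhi' : (e : ℤ) ≤ (7 : ℤ) ^ a₀ * ((7 : ℤ) - 1) := by exact_mod_cast hhi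
    rcases Nat.lt_or_ge e 3 with hlt3 | hge3
    · exact HexRad.logExponent_lt_floor_small k l e a₀ _ h11 hodd hk he1 (by omega) hd hlo'
    · obtain ⟨F, hF, hcrit⟩ := hrow
      exact HexRad.logExponent_lt_floor_of_criterion₃ k l e _ a₀ S F _ h11 hge3 hbound hd hlo' hhi' hloS hhiS hF hcrit
  -- rewrite it as the hypothesis of the genuine-`K` envelope decl
  have hi1 : ((i₀ : ℕ) : ℝ) + 1 = ((jj : ℕ) : ℝ) := by
    have h : (i₀ : ℕ) + 1 = jj := by rw [hi₀v, hjj]; omega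
    exact_mod_cast h
  have hi2 : ((i₀ : ℕ) : ℝ) + 2 = ((jj : ℕ) : ℝ) + 1 := by linarith
  have hsq : ((((((i₀ : ℕ) + 1) ^ 2 * P : ℕ) : ℤ) : ℝ)) / absRamificationIdx 7 (kOf (pilotDataOfK T.D T.K) 7 x₀)
      = (((jj : ℕ) : ℝ)) ^ 2 * k / l := by
    have h1 : ((((((i₀ : ℕ) + 1) ^ 2 * P : ℕ) : ℤ) : ℝ)) = (((i₀ : ℕ) : ℝ) + 1) ^ 2 * ((P : ℤ) : ℝ) := by push_cast; ring
    rw [h1, hi1, ← he, mul_div_assoc, hμ, mul_div_assoc]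
  have henvZ : (((((7 : ℕ) : ℤ) ^ a₀ - (absRamificationIdx 7 (kOf (pilotDataOfK T.D T.K) 7 x₀) : ℤ) * (a₀ : ℤ) : ℤ) : ℝ)) / absRamificationIdx 7 (kOf (pilotDataOfK T.D T.K) 7 x₀)
      = -((a₀ : ℝ) - (7 : ℝ) ^ a₀ / e) := by
    rw [← he]
    push_cast
    field_simp
    ring
  have hlt : (((P : ℤ) : ℝ)) / absRamificationIdx 7 (kOf (pilotDataOfK T.D T.K) 7 x₀) <
      ⌊((((((i₀ : ℕ) + 1) ^ 2 * P : ℕ) : ℤ) : ℝ)) / absRamificationIdx 7 (kOf (pilotDataOfK T.D T.K) 7 x₀)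
          - (((i₀ : ℕ) : ℝ) + 1) * differentOrd 7 (kOf (pilotDataOfK T.D T.K) 7 x₀)
          - (((i₀ : ℕ) : ℝ) + 2) * logRadiusA 7 (absRamificationIdx 7 (kOf (pilotDataOfK T.D T.K) 7 x₀))⌋
        + (((i₀ : ℕ) : ℝ) + 2) * ((((((7 : ℕ) : ℤ) ^ a₀ - (absRamificationIdx 7 (kOf (pilotDataOfK T.D T.K) 7 x₀) : ℤ) * (a₀ : ℤ) : ℤ) : ℝ)) / absRamificationIdx 7 (kOf (pilotDataOfK T.D T.K) 7 x₀)) := by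
    rw [hsq, hi1, hi2, henvZ, ← he, hμ]
    linarith
  exact GenuineK.not_pilotKummerCompatHull_chosen_of_star_envelope T.D M archPk archSub Ψ act Mmod region frobAdm frobLogvol
    frobΨ frobMmod unitImage ballImage thetaDiv n lat sig split qData qK ⟨7, by norm_num⟩ i₀ x₀ P hP a₀ hlo hhi hlt

/-- **THE DECIDED RAD TABLE.** For `(l, k)` with `l ∈ {11, 13, 17, 19, 23, 29, 31, 37, 41, 43}` and `k ≥ k♯(l) = 30, 29, 29, 29, 28, 29, 29,
29, 30, 30` respectively: at EVERY genuine Θ-volume datum over `(ratPoint λ_k, l)`, for every choice of the free binders, the hull-level clause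
S_H FAILS (rows `HexRad.turning_<l>` of p462893 and `HexRad.criterion₃_of_le_<l>` of `HexDepthRadCoreAllE` fed into
`not_pilotKummerCompatHull_lamSeven_of_rad_criterion`). R-W: the WINDOW-TABLE classes `HEX:k:l` with `k ≥ k♯(l)` are REFUTED BY THEOREM here
(the tame-route floor `HexFloor.exists_deep_place_lamSeven_of_table` starts at `35, 34, 33, …`). [cite: Mochizuki2012, IUTchIII Cor. 3.12 Step (xi-f) p. 184]
[claim: Mochizuki2012, status: disputed] -/
theorem not_pilotKummerCompatHull_lamSeven_of_rad_table {k l : ℕ} (hl : l.Prime)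
    (hkl : (l = 11 ∧ 30 ≤ k) ∨
      (l = 13 ∧ 29 ≤ k) ∨
      (l = 17 ∧ 29 ≤ k) ∨
      (l = 19 ∧ 29 ≤ k) ∨
      (l = 23 ∧ 28 ≤ k) ∨
      (l = 29 ∧ 29 ≤ k) ∨
      (l = 31 ∧ 29 ≤ k) ∨
      (l = 37 ∧ 29 ≤ k) ∨
      (l = 41 ∧ 30 ≤ k) ∨
      (l = 43 ∧ 30 ≤ k))
    (T : Cor22.ThetaVolumeDatumAt (ratPoint ((2 : ℚ)⁻¹ + 2 / 7 ^ k)) l) :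
    letI := T.instFieldF; letI := T.instNumberFieldF; letI := T.instAlgebraF; letI := T.instFieldK
    letI := T.instNumberFieldK; letI := T.instAlgebraK; letI := T.instFieldFbar; letI := T.instAlgebraFbar
    letI := T.instAlgebraKFbar; letI := T.instIsElliptic
    ∀ (M : Type) [Field M] [NumberField M]
      (archPk : ∀ (j : (thetaIndex (pilotDataOfK T.D T.K)).Label) (vQ : (thetaIndex (pilotDataOfK T.D T.K)).VQ),
        Set ((logShellsDH (pilotDataOfK T.D T.K) (analyticLogv T.K)).Packet j vQ))
      (archSub : ∀ (j : (thetaIndex (pilotDataOfK T.D T.K)).Label) (v : (thetaIndex (pilotDataOfK T.D T.K)).V),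
        Set ((logShellsDH (pilotDataOfK T.D T.K) (analyticLogv T.K)).Packet j ((thetaIndex (pilotDataOfK T.D T.K)).over v)))
      (Ψ : ℤ → ∀ v : (thetaIndex (pilotDataOfK T.D T.K)).V, v ∈ (thetaIndex (pilotDataOfK T.D T.K)).Vbad →
        Set ((logShellsDH (pilotDataOfK T.D T.K) (analyticLogv T.K)).StarPacket v))
      (act : ℤ → ∀ v : (thetaIndex (pilotDataOfK T.D T.K)).V, v ∈ (thetaIndex (pilotDataOfK T.D T.K)).Vbad →
        (logShellsDH (pilotDataOfK T.D T.K) (analyticLogv T.K)).StarPacket v →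
          Module.End ℚ ((logShellsDH (pilotDataOfK T.D T.K) (analyticLogv T.K)).StarPacket v))
      (Mmod : ℤ → ∀ j : (thetaIndex (pilotDataOfK T.D T.K)).LabelStar,
        Set ((logShellsDH (pilotDataOfK T.D T.K) (analyticLogv T.K)).GlobalPacket j.1))
      (region : ℤ → ∀ j : (thetaIndex (pilotDataOfK T.D T.K)).LabelStar, FinDivisor M →
        ∀ vQ : (thetaIndex (pilotDataOfK T.D T.K)).VQ, Set ((logShellsDH (pilotDataOfK T.D T.K) (analyticLogv T.K)).Packet j.1 vQ))
      (frobAdm : ℤ → ℤ → ∀ (j : (thetaIndex (pilotDataOfK T.D T.K)).Label) (vQ : (thetaIndex (pilotDataOfK T.D T.K)).VQ),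
        Set ((logShellsDH (pilotDataOfK T.D T.K) (analyticLogv T.K)).Packet j vQ) → Prop)
      (frobLogvol : ℤ → ℤ → ∀ (j : (thetaIndex (pilotDataOfK T.D T.K)).Label) (vQ : (thetaIndex (pilotDataOfK T.D T.K)).VQ),
        Set ((logShellsDH (pilotDataOfK T.D T.K) (analyticLogv T.K)).Packet j vQ) → ℝ)
      (frobΨ : ℤ → ℤ → ∀ v : (thetaIndex (pilotDataOfK T.D T.K)).V, v ∈ (thetaIndex (pilotDataOfK T.D T.K)).Vbad →
        Set ((logShellsDH (pilotDataOfK T.D T.K) (analyticLogv T.K)).StarPacket v))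
      (frobMmod : ℤ → ℤ → ∀ j : (thetaIndex (pilotDataOfK T.D T.K)).LabelStar,
        Set ((logShellsDH (pilotDataOfK T.D T.K) (analyticLogv T.K)).GlobalPacket j.1))
      (unitImage : ℤ → ℤ → ℕ → ∀ (j : (thetaIndex (pilotDataOfK T.D T.K)).Label) (vQ : (thetaIndex (pilotDataOfK T.D T.K)).VQ),
        Set ((logShellsDH (pilotDataOfK T.D T.K) (analyticLogv T.K)).Packet j vQ))
      (ballImage : ℤ → ℤ → ∀ (j : (thetaIndex (pilotDataOfK T.D T.K)).Label) (vQ : (thetaIndex (pilotDataOfK T.D T.K)).VQ),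
        Set ((logShellsDH (pilotDataOfK T.D T.K) (analyticLogv T.K)).Packet j vQ))
      (thetaDiv : ℤ → ℤ → LgpDivisor M (thetaIndex (pilotDataOfK T.D T.K)).lstar)
      (n : ℤ) {HT : Type} {LogLink : HT → HT → Type} {IsFull : ∀ {s t : HT}, LogLink s t → Prop}
      (lat : LGPGaussianLogThetaLattice LogLink IsFull)
      {Frd : Type} {IsoF : Frd → Frd → Type} {Ob : Frd → Type} {realify : Frd → Frd} {Strip : Type}
      {IsoS : Strip → Strip → Type} {Mv : ∀ v : (thetaIndex (pilotDataOfK T.D T.K)).V, v ∈ (thetaIndex (pilotDataOfK T.D T.K)).Vbad → Type}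
      [∀ v h, Monoid (Mv v h)]
      (sig : GlobalLGPFrobenioidSignature (thetaIndex (pilotDataOfK T.D T.K)).lstar (thetaIndex (pilotDataOfK T.D T.K)).V
        (· ∈ (thetaIndex (pilotDataOfK T.D T.K)).Vbad) Frd IsoF Ob realify Strip IsoS Mv)
      (split : SplittingMonoids Mv) {ObΔ : Type}
      {N : ∀ v : (thetaIndex (pilotDataOfK T.D T.K)).V, v ∈ (thetaIndex (pilotDataOfK T.D T.K)).Vbad → Type}
      [∀ v h, Monoid (N v h)] (qData : QPilotData ObΔ N)
      (qK : ∀ v : (thetaIndex (pilotDataOfK T.D T.K)).V, v ∈ (thetaIndex (pilotDataOfK T.D T.K)).Vbad →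
        Set ((logShellsDH (pilotDataOfK T.D T.K) (analyticLogv T.K)).StarPacket v)),
    ¬ Cor312Vol.PilotKummerCompatHull
        (LatticeSituation.ofShells (logShellsDH (pilotDataOfK T.D T.K) (analyticLogv T.K)) M archPk archSub
          (summandPiecesPr (pilotDataOfK T.D T.K) (logvAnalytic_analyticLogv (F := T.K))).Adm
          (summandPiecesPr (pilotDataOfK T.D T.K) (logvAnalytic_analyticLogv (F := T.K))).logvol Ψ act Mmod region frobAdm
          frobLogvol frobΨ frobMmod unitImage ballImage thetaDiv)
        (settingPrVolSharp (pilotDataOfK T.D T.K) (logvAnalytic_analyticLogv (F := T.K)) M archPk archSub Ψ act Mmod region n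
          lat sig split qData (exists_realising_qIdeles_pilotDataOfK T.D).choose (exists_realising_thetaIdeles_pilotDataOfK T.D).choose
          (exists_realising_qIdeles_pilotDataOfK T.D).choose_spec.1 (exists_realising_qIdeles_pilotDataOfK T.D).choose_spec.2.1)
        (fun _ => Cor312.Setting.qRegion
          (settingPrVolSharp (pilotDataOfK T.D T.K) (logvAnalytic_analyticLogv (F := T.K)) M archPk archSub Ψ act Mmod region n
            lat sig split qData (exists_realising_qIdeles_pilotDataOfK T.D).choose (exists_realising_thetaIdeles_pilotDataOfK T.D).choose
            (exists_realising_qIdeles_pilotDataOfK T.D).choose_spec.1 (exists_realising_qIdeles_pilotDataOfK T.D).choose_spec.2.1))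
        qK := by
  rcases hkl with ⟨rfl, hk⟩ | ⟨rfl, hk⟩ | ⟨rfl, hk⟩ | ⟨rfl, hk⟩ | ⟨rfl, hk⟩ | ⟨rfl, hk⟩ | ⟨rfl, hk⟩ | ⟨rfl, hk⟩ | ⟨rfl, hk⟩ | ⟨rfl, hk⟩
  · exact not_pilotKummerCompatHull_lamSeven_of_rad_criterion (k := k) (by omega) hl (by norm_num)
      turning_11.1 turning_11.2 (criterion₃_of_le_11 hk) T
  · exact not_pilotKummerCompatHull_lamSeven_of_rad_criterion (k := k) (by omega) hl (by norm_num)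
      turning_13.1 turning_13.2 (criterion₃_of_le_13 hk) T
  · exact not_pilotKummerCompatHull_lamSeven_of_rad_criterion (k := k) (by omega) hl (by norm_num)
      turning_17.1 turning_17.2 (criterion₃_of_le_17 hk) T
  · exact not_pilotKummerCompatHull_lamSeven_of_rad_criterion (k := k) (by omega) hl (by norm_num)
      turning_19.1 turning_19.2 (criterion₃_of_le_19 hk) T
  · exact not_pilotKummerCompatHull_lamSeven_of_rad_criterion (k := k) (by omega) hl (by norm_num)
      turning_23.1 turning_23.2 (criterion₃_of_le_23 hk) T
  · exact not_pilotKummerCompatHull_lamSeven_of_rad_criterion (k := k) (by omega) hl (by norm_num)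
      turning_29.1 turning_29.2 (criterion₃_of_le_29 hk) T
  · exact not_pilotKummerCompatHull_lamSeven_of_rad_criterion (k := k) (by omega) hl (by norm_num)
      turning_31.1 turning_31.2 (criterion₃_of_le_31 hk) T
  · exact not_pilotKummerCompatHull_lamSeven_of_rad_criterion (k := k) (by omega) hl (by norm_num)
      turning_37.1 turning_37.2 (criterion₃_of_le_37 hk) T
  · exact not_pilotKummerCompatHull_lamSeven_of_rad_criterion (k := k) (by omega) hl (by norm_num)
      turning_41.1 turning_41.2 (criterion₃_of_le_41 hk) T
  · exact not_pilotKummerCompatHull_lamSeven_of_rad_criterion (k := k) (by omega) hl (by norm_num)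
      turning_43.1 turning_43.2 (criterion₃_of_le_43 hk) T

end HexRad

end Summit.ABC.IUTFork.Conditional

end
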